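import Literature.NumberTheory.EllipticCurves.Kato2004.IwasawaCohomologyCoeff
import Literature.NumberTheory.EllipticCurves.CyclotomicLayerRhoTatePairingPk
import Literature.NumberTheory.EllipticCurves.Sprung2012.ColemanMaps
import Literature.NumberTheory.EllipticCurves.Kobayashi2003.SignedSelmer
import Literature.NumberTheory.EllipticCurves.PlusMinusPAdicLFunction
import Literature.NumberTheory.EllipticCurves.SharpFlatPAdicLFunctionCoeffField
import Literature.NumberTheory.EllipticCurves.GreenbergVatsal2000.GreenbergSelmerGroups
import Literature.NumberTheory.EllipticCurves.GreenbergSelmer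
import Literature.NumberTheory.EllipticCurves.SubgroupSelmer
import Literature.NumberTheory.GaloisRepresentations.ContinuousH1
import Mathlib.Algebra.Module.CharacterModule
import Mathlib.RingTheory.Localization.FractionRing
import HarnessLib

/-!
# Route `ResidualThetaTransportAtTwo` (RTT) — definition file: the ONE-PAIR PIN BUNDLE `OnePairPins` of line `onepair`
# (crux RSL_g `ResidualSignedLambdaLowerCMAtTwo`, stmt-BirchSwinnertonDyer-22608) and the data-valued λ-abbreviations its stub texts use

Cell `bsd-wall`, LEAD `prover-bsd-wall-rtt-p2` g18, on director-bsd's ruling Q63′ «GO P2′» (2026-08-29T03:05:06Z): the registered stub texts of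
`Cruxes/ResidualSignedLambdaLowerCMAtTwo/Lines/onepair.lean` (skeleton v2c/v2d) repeat a 6 420-character block of PINNED OBJECTS — the value-pinned
data of the one-pair duality road (`Cruxes/ResidualThetaCountLowerPureAtTwo/SKELETON-V2-CUT-g16.md` (C1)–(C6), memo `V2A-PINS-AND-ENTRY-g17.md`) —
in front of every clause, which puts the PRINT-HOLD stub `stub_katoZetaCMAtTwo` (KZ_g, 13 315 chars) above both the ledger's item-statement bound and
the registered-stub record bound. THIS FILE bundles that block ONCE, as a `structure`, so that the KZ_g item text (pen `bsd-wall-p2`), the S3 stub in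
its (C2) «true dependencies» form, and the S57 split stubs (`localDualAwayTwo`, `reciprocity`, `deepHalfAtTwoStrict`, `deepHalfAwayTwo`, critic's
STUB-PLAN rev 17 Q70) are all stated over ONE named object `π : OnePairPins …` and its projections.

CONTENTS (data + hypothesis structure and DATA-valued abbreviations only — no `Prop`-valued definition, no instance, no notation, no attribute,
nothing asserted; every field is VERBATIM a binder of the registered texts with `Set.range ι ↦ S`):
* `OnePairPins S W κ γ S₀ n ρ Θ hΘ I Sg` — parameters = the objects the crux's own binders introduce (coefficient set `S` (= `Set.range ι`), the
  curve `W`, the `ℤ₂`-extension `κ` with generator `γ`, the bad set `S₀`, the multiplicity `n`, the framed representation `ρ`, the transport `Θ`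
  with its equivariance `hΘ` at the places above `2`, Kato's datum `I : IwasawaH1DataCoeff ρ 2 κ γ` (K0, BY NAME), the Selmer-type subgroup `Sg`
  with its `𝒪`-module structure); FIELDS = the pins: the place `v ∋ 2`; Frobenius data `t₀, bO, bO'` of `𝒪/ℤ₂` (p678260); primitive roots `ζ`;
  the self-dual tower `ePk` with its value formula (p675174/p677952); THE `ℤ₂`-valued layer pairing family `pair` pinned by its residues
  `CyclotomicLayer.rhoLayerPairingPk` (p673067/p674128); the glue `locd₂` pinned by the layer formula (p679036); the plus Coleman map `col` over
  `ℤ₂` pinned by its congruences, onto, with kernel the annihilator of the plus points (p668073); the rank `f` with an additive basis `B` of `𝒪`;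
  the strict-and-primitive submodule `Sel₀ ≤ Sg` pinned by its membership predicate (p671034/p667294).
* `lamO S X` — `λ_𝒪(X) := dim_{Frac 𝒪} (Frac 𝒪 ⊗_𝒪 X)`; `lamTwo 2 X` — `λ_{ℤ₂}(X) := dim_{ℚ₂} (ℚ₂ ⊗_{ℤ₂} X)` (the two rank currencies of (C1)).
* `π.cvec x` — `𝒸 x := (col (locd₂ x ∘ single i))_i ∈ ℤ₂⟦X⟧ⁿ`; `π.colocdQuot z` — `ℤ₂⟦X⟧ⁿ ⧸ span_{ℤ₂⟦X⟧} 𝒸(Λ_𝒪 z)`; `zetaQuot I z` — `𝐇¹ ⧸ Λ_𝒪 z`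
  (reducible type abbreviations, so that `Module.Finite ℚ_[2] (ℚ₂ ⊗ π.colocdQuot z)` etc. find their instances by unfolding).
* projection lemmas restating the four value pins as theorems about `π` (`π.toZModPow_pair`, `π.locd₂_layer`, `π.col_eq_zero_iff`, `π.mem_Sel₀_iff`).

NOT HERE: any statement of S3 / KZ_g or of a split stub (those are registered texts / a route item); any existence claim (the pins EXIST by the
landed theorems p677952, p678260, p679036, p668073, p679392, p671034, p667294 — assembled in `LambdaLowerBoundO.residualSignedLambdaLowerCMAtTwo_of_parts`,
p682462 — but nothing of that is restated here). BSD is not proved by any of this; RSL_g is OPEN.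

References: [Kato2004Asterisque] §12.2–12.5, §13.8, §14.9; [Kobayashi2003] Thm. 6.2, (8.23); [PerrinRiou1994Invent] §3.6.1.
-/

set_option autoImplicit false
-- the Theorems namespace of this sub repeats the summit name by design (D-0017 nested layout)
set_option linter.dupNamespace false

noncomputable section

open scoped Classical TensorProduct

namespace Summit.BirchSwinnertonDyer.BirchSwinnertonDyer.Theorems.OnePair

open Literature.NumberTheory.EllipticCurves Literature.NumberTheory.EllipticCurves.GreenbergSelmer
open Literature.NumberTheory.GaloisRepresentations NumberField IsDedekindDomain Field
open Literature.NumberTheory.EllipticCurves GreenbergSelmer GreenbergVatsal2000 Kobayashi2003 Literature.NumberTheory.GaloisRepresentations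
  IsDedekindDomain NumberField Field Rat.HeightOneSpectrum PowerSeries

/-! ## The two rank currencies -/

/-- `λ_𝒪(X) := dim_{Frac 𝒪} (Frac 𝒪 ⊗_𝒪 X)` — the `𝒪`-rank of an `𝒪 = padicCoeffIntegers S`-module (`0` when `Frac 𝒪 ⊗ X` is not finite-dimensional;
the stub texts pair it with a `Module.Finite` clause where an upper bound is meant). [cite: Kato2004Asterisque, §13.8 (p. 228)] -/
def lamO {p : ℕ} [Fact p.Prime] (S : Set (PadicAlgCl p)) (X : Type*) [AddCommGroup X] [Module ↥(padicCoeffIntegers S) X] : ℕ :=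
  Module.finrank (FractionRing ↥(padicCoeffIntegers S)) (TensorProduct ↥(padicCoeffIntegers S) (FractionRing ↥(padicCoeffIntegers S)) X)

/-- `λ_{ℤ_p}(X) := dim_{ℚ_p} (ℚ_p ⊗_{ℤ_p} X)` — the `ℤ_p`-rank of a `ℤ_p`-module (`0` when infinite-dimensional). [cite: Kato2004Asterisque, §13.8 (p. 228)] -/
def lamTwo (p : ℕ) [Fact p.Prime] (X : Type*) [AddCommGroup X] [Module ℤ_[p] X] : ℕ :=
  Module.finrank ℚ_[p] (TensorProduct ℤ_[p] ℚ_[p] X)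

/-- Unfolding `lamO` (definitional). [cite: Kato2004Asterisque, §13.8 (p. 228)] -/
theorem lamO_eq {p : ℕ} [Fact p.Prime] (S : Set (PadicAlgCl p)) (X : Type*) [AddCommGroup X] [Module ↥(padicCoeffIntegers S) X] :
    lamO S X = Module.finrank (FractionRing ↥(padicCoeffIntegers S))
      (TensorProduct ↥(padicCoeffIntegers S) (FractionRing ↥(padicCoeffIntegers S)) X) :=
  rfl

/-- Unfolding `lamTwo` (definitional). [cite: Kato2004Asterisque, §13.8 (p. 228)] -/
theorem lamTwo_eq (p : ℕ) [Fact p.Prime] (X : Type*) [AddCommGroup X] [Module ℤ_[p] X] :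
    lamTwo p X = Module.finrank ℚ_[p] (TensorProduct ℤ_[p] ℚ_[p] X) :=
  rfl

/-! ## The pin bundle -/

section Pins

variable (S : Set (PadicAlgCl 2)) (W : WeierstrassCurve ℚ) [W.IsElliptic] (κ : ZpExtension ℚ 2) (γ : absoluteGaloisGroup ℚ)
  (S₀ : Finset (HeightOneSpectrum (𝓞 ℚ))) (n : ℕ) (ρ : FramedGaloisRep ℚ ↥(padicCoeffIntegers S) 2)
  (Θ : ∀ v : HeightOneSpectrum (𝓞 ℚ), ((2 : ℕ) : 𝓞 ℚ) ∈ v.asIdeal → (Cofree ρ ↥(padicCoeffField S) ≃+ (Fin n → ↥(W.geomPrimaryTorsion 2))))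
  (hΘ : ∀ v hv (δ : absoluteGaloisGroup (v.adicCompletion ℚ)) m i,
    Θ v hv (resGalOfEmb (closureEmb (K := ℚ) (v.adicCompletion ℚ)) δ • m) i = resGalOfEmb (closureEmb (K := ℚ) (v.adicCompletion ℚ)) δ • Θ v hv m i)
  (I : Kato2004.IwasawaH1DataCoeff (FramedGaloisRep.toGaloisRep ρ) 2 κ γ)
  (Sg : AddSubgroup (subgroupH1 κ.kerSubgroup (Cofree ρ ↥(padicCoeffField S)))) [Module ↥(padicCoeffIntegers S) ↥Sg]

/-- **The one-pair pin bundle** of line `onepair` (crux RSL_g, stmt-BirchSwinnertonDyer-22608): every field is VERBATIM one binder of the pinned-object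
block of the registered stub texts (`Set.range ι ↦ S`). Data fields: the place `v` above `2`; Frobenius data `t₀ : 𝒪 →+ ℤ₂` (`ℤ₂`-linear) with dual
families `bO, bO'`; a compatible choice of primitive `2^k`-th roots `ζ`; the self-dual tower `ePk : A_ρ[2^k] × A_ρ[2^k] → μ` (bimultiplicative, Galois,
value formula `e_k(2^{-k}s, 2^{-k}t) = ζ_k^{t₀(s ∧ t)}`); THE layer pairing family `pair m : H¹(Γ_m, T_ρ) →+ (E(ℚ_{m,v})ⁿ →+ ℤ₂)` pinned by its residues
`rhoLayerPairingPk`; the glue `locd₂ : 𝐇¹ →+ ((E(ℚ_{∞,v}))ⁿ →+ ℤ₂)` pinned by the layer formula; the plus Coleman map `col` over `ℤ₂` pinned by its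
congruences (onto; kernel = functionals vanishing on the plus points); the rank `f` of `𝒪` over `ℤ₂` with a basis `B`; the submodule `Sel₀ ≤ Sg`
of classes strict at the places above `2` and primitive at `S₀`, pinned by its membership predicate. Nothing is asserted: a term of this type is
BUILT from the landed existence theorems (p677952, p678260, p679036, p668073, p679392, p671034, p667294) by the line's composition.
[cite: Kato2004Asterisque, §13.8 (pp. 228–229), §14.9 (p. 239)] [cite: Kobayashi2003, Thm. 6.2 and (8.23) (p. 18)] [cite: PerrinRiou1994Invent, §3.6.1] -/
structure OnePairPins : Type where
  /-- the place of `ℚ` above `2` -/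
  v : HeightOneSpectrum (𝓞 ℚ)
  /-- `2 ∈ v` -/
  hv : ((2 : ℕ) : 𝓞 ℚ) ∈ v.asIdeal
  /-- Frobenius datum: a generator `t₀` of `Hom_{ℤ₂}(𝒪, ℤ₂)` -/
  t₀ : ↥(padicCoeffIntegers S) →+ ℤ_[2]
  /-- `t₀` is `ℤ₂`-linear -/
  ht₀ : ∀ (c : ℤ_[2]) (a : ↥(padicCoeffIntegers S)), t₀ (padicIntToCoeffIntegers S c * a) = c * t₀ a
  /-- size of the dual families -/
  nb : ℕ
  /-- dual family `bO` -/
  bO : Fin nb → ↥(padicCoeffIntegers S)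
  /-- dual family `bO'` -/
  bO' : Fin nb → ↥(padicCoeffIntegers S)
  /-- the dual-basis expansion `a = Σ_i t₀(a bO'_i) bO_i` -/
  hbO : ∀ a : ↥(padicCoeffIntegers S), a = ∑ i, padicIntToCoeffIntegers S (t₀ (a * bO' i)) * bO i
  /-- a choice of `2^k`-th roots of unity -/
  ζ : ℕ → AlgebraicClosure ℚ
  /-- `ζ k` is primitive of order `2^k` -/
  hζ : ∀ k, IsPrimitiveRoot (ζ k) (2 ^ k)
  /-- the self-dual tower `e_k : A_ρ[2^k] × A_ρ[2^k] → ℚ̄` -/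
  ePk : ∀ k : ℕ, ↥(AddSubgroup.torsionBy (Cofree ρ ↥(padicCoeffField S)) ((2 ^ k : ℕ) : ℤ)) →
    ↥(AddSubgroup.torsionBy (Cofree ρ ↥(padicCoeffField S)) ((2 ^ k : ℕ) : ℤ)) → AlgebraicClosure ℚ
  /-- values in `μ_{2^k}` -/
  hμPk : ∀ k a b, ePk k a b ^ (2 ^ k) = 1
  /-- additive in the first variable -/
  hadd₁Pk : ∀ k a₁ a₂ b, ePk k (a₁ + a₂) b = ePk k a₁ b * ePk k a₂ b
  /-- additive in the second variable -/
  hadd₂Pk : ∀ k a b₁ b₂, ePk k a (b₁ + b₂) = ePk k a b₁ * ePk k a b₂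
  /-- Galois equivariant -/
  hgalPk : ∀ k (σ : absoluteGaloisGroup ℚ) (a b : ↥(AddSubgroup.torsionBy (Cofree ρ ↥(padicCoeffField S)) ((2 ^ k : ℕ) : ℤ))),
    σ • ePk k a b = ePk k (cofreeTorsionGaloisModule S ρ _ σ a) (cofreeTorsionGaloisModule S ρ _ σ b)
  /-- the value formula `e_k(2^{-k}s, 2^{-k}t) = ζ_k^{t₀(s₀t₁ − s₁t₀)}` -/
  hePk : ∀ k (s t : Fin 2 → ↥(padicCoeffIntegers S)), ePk k (divPowCofreeMkTorsion S ρ k s) (divPowCofreeMkTorsion S ρ k t) =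
    ζ k ^ (PadicInt.toZModPow k (t₀ (s 0 * t 1 - s 1 * t 0))).val
  /-- THE `ℤ₂`-valued layer pairing family `⟨x, Q⟩_m ∈ ℤ₂`, `x ∈ H¹(Γ_m, T_ρ)`, `Q ∈ E(ℚ_{m,v})ⁿ` -/
  pair : ∀ m : ℕ, H1 (FramedGaloisRep.toGaloisRep ρ) (κ.layerSubgroup m) →+
    ((Fin n → ↥(localLayerPointsOfEmb κ (closureEmb (K := ℚ) (v.adicCompletion ℚ)) W m)) →+ ℤ_[2])
  /-- `pair` is pinned by its residues `rhoLayerPairingPk` modulo every `2^k` -/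
  hpair : ∀ (m k : ℕ) (x : H1 (FramedGaloisRep.toGaloisRep ρ) (κ.layerSubgroup m))
    (Q : Fin n → ↥(localLayerPointsOfEmb κ (closureEmb (K := ℚ) (v.adicCompletion ℚ)) W m)),
    PadicInt.toZModPow k (pair m x Q) = CyclotomicLayer.rhoLayerPairingPk S ρ W ePk hμPk hadd₁Pk hadd₂Pk hgalPk (Θ v hv) κ v (hΘ v hv) m k x Q
  /-- the glue `locd₂ : 𝐇¹ →+ ((E(ℚ_{∞,v}))ⁿ →+ ℤ₂)` -/
  locd₂ : I.H →+ ((Fin n → ↥(Sprung2012.localTowerPointsOfEmb κ (closureEmb (K := ℚ) (v.adicCompletion ℚ)) W)) →+ ℤ_[2])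
  /-- `locd₂` is pinned by the layer formula `locd₂ x (Q at layer m) = ⟨proj_m x, Q⟩_m` -/
  hlocd₂ : ∀ (m : ℕ) (x : I.H) (Q : Fin n → localPoints W (v.adicCompletion ℚ))
    (hQ : ∀ i, Q i ∈ localLayerPointsOfEmb κ (closureEmb (K := ℚ) (v.adicCompletion ℚ)) W m),
    locd₂ x (fun i => ⟨Q i, Sprung2012.localLayerPointsOfEmb_le_localTowerPointsOfEmb κ (closureEmb (K := ℚ) (v.adicCompletion ℚ)) W m (hQ i)⟩) =
      pair m (I.proj m x) (fun i => ⟨Q i, hQ i⟩)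
  /-- the plus Coleman map over `ℤ₂` on functionals of the tower points -/
  col : (↥(Sprung2012.localTowerPointsOfEmb κ (closureEmb (K := ℚ) (v.adicCompletion ℚ)) W) →+ ℤ_[2]) →ₗ[ℤ_[2]] PowerSeries ℤ_[2]
  /-- `col` is pinned by its congruences along a trace-compatible system `dH` under a topological generator `gH` -/
  hcol : ∃ (gH : absoluteGaloisGroup (v.adicCompletion ℚ)) (dH : ℕ → localPoints W (v.adicCompletion ℚ))
    (hdA : ∀ m j, gH ^ j • dH m ∈ Sprung2012.localTowerPointsOfEmb κ (closureEmb (K := ℚ) (v.adicCompletion ℚ)) W),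
    κ.IsTopGenerator (resGalOfEmb (closureEmb (K := ℚ) (v.adicCompletion ℚ)) gH) ∧
    (∀ m, dH m ∈ localLayerPointsOfEmb κ (closureEmb (K := ℚ) (v.adicCompletion ℚ)) W m) ∧
    (∀ m, localTraceOfEmb κ (closureEmb (K := ℚ) (v.adicCompletion ℚ)) W (m + 1) (m + 2) (dH (m + 2)) = -dH m) ∧
    (∀ b ∈ localLayerPointsOfEmb κ (closureEmb (K := ℚ) (v.adicCompletion ℚ)) W 0, dH 0 ≠ 2 • b) ∧
    (∀ (z : ↥(Sprung2012.localTowerPointsOfEmb κ (closureEmb (K := ℚ) (v.adicCompletion ℚ)) W) →+ ℤ_[2]) (m : ℕ),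
      (((cyclotomicOmega 2 (2 * m)).map (Int.castRingHom ℤ_[2]) : Polynomial ℤ_[2]) : PowerSeries ℤ_[2]) ∣
        ((∑ j ∈ Finset.range (2 ^ (2 * m)), Polynomial.C (z ⟨gH ^ j • dH (2 * m), hdA (2 * m) j⟩) * (Polynomial.X + 1) ^ j :
            Polynomial ℤ_[2]) : PowerSeries ℤ_[2]) +
          (-1 : PowerSeries ℤ_[2]) ^ m * (((cyclotomicOmegaMinus 2 (2 * m)).map (Int.castRingHom ℤ_[2]) : Polynomial ℤ_[2]) : PowerSeries ℤ_[2]) *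
            col z) ∧
    (∀ (z : ↥(Sprung2012.localTowerPointsOfEmb κ (closureEmb (K := ℚ) (v.adicCompletion ℚ)) W) →+ ℤ_[2]) (Lz : PowerSeries ℤ_[2]),
      (∀ m : ℕ, (((cyclotomicOmega 2 (2 * m)).map (Int.castRingHom ℤ_[2]) : Polynomial ℤ_[2]) : PowerSeries ℤ_[2]) ∣
        ((∑ j ∈ Finset.range (2 ^ (2 * m)), Polynomial.C (z ⟨gH ^ j • dH (2 * m), hdA (2 * m) j⟩) * (Polynomial.X + 1) ^ j :
            Polynomial ℤ_[2]) : PowerSeries ℤ_[2]) +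
          (-1 : PowerSeries ℤ_[2]) ^ m * (((cyclotomicOmegaMinus 2 (2 * m)).map (Int.castRingHom ℤ_[2]) : Polynomial ℤ_[2]) : PowerSeries ℤ_[2]) *
            Lz) → Lz = col z)
  /-- `col` is onto -/
  hcol_surj : Function.Surjective col
  /-- `ker col` = the functionals vanishing on every layer of plus points -/
  hcol_ker : ∀ z : ↥(Sprung2012.localTowerPointsOfEmb κ (closureEmb (K := ℚ) (v.adicCompletion ℚ)) W) →+ ℤ_[2],
    col z = 0 ↔ ∀ (m : ℕ) (x : localPoints W (v.adicCompletion ℚ)) (hx : x ∈ signedLocalPoints κ (v.adicCompletion ℚ) W 1 m),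
      z ⟨x, Sprung2012.localLayerPointsOfEmb_le_localTowerPointsOfEmb κ (closureEmb (K := ℚ) (v.adicCompletion ℚ)) W m
        (signedLocalPointsOfEmb_le κ (closureEmb (K := ℚ) (v.adicCompletion ℚ)) W 1 m hx)⟩ = 0
  /-- `f = rank_{ℤ₂} 𝒪` -/
  f : ℕ
  /-- an additive basis `B : ℤ₂^f ≃+ 𝒪` -/
  B : (Fin f → ℤ_[2]) ≃+ ↥(padicCoeffIntegers S)
  /-- `B` is `ℤ₂`-linear -/
  hB : ∀ (c : ℤ_[2]) (y : Fin f → ℤ_[2]), B (c • y) = padicIntToCoeffIntegers S c * B y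
  /-- the strict-and-primitive submodule `Sel₀ ≤ Sg` -/
  Sel₀ : Submodule ↥(padicCoeffIntegers S) ↥Sg
  /-- membership in `Sel₀`: strict (trivial Kummer datum) at every place above `2`, unramified at `S₀` -/
  hSel₀ : ∀ s : ↥Sg, s ∈ Sel₀ ↔
    (∀ (v' : HeightOneSpectrum (𝓞 ℚ)) (hv' : ((2 : ℕ) : 𝓞 ℚ) ∈ v'.asIdeal) (σ : absoluteGaloisGroup ℚ),
      ∃ (φ : contOneCocycles (discreteTopRep ↥κ.kerSubgroup (Cofree ρ ↥(padicCoeffField S))))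
        (Q : Fin n → localPoints W (v'.adicCompletion ℚ)) (k : ℕ),
        oneCocycleClass (discreteTopRep ↥κ.kerSubgroup (Cofree ρ ↥(padicCoeffField S))) φ =
          conjH1 κ.kerSubgroup (Cofree ρ ↥(padicCoeffField S)) σ (s : subgroupH1 κ.kerSubgroup (Cofree ρ ↥(padicCoeffField S))) ∧
        (∀ i, (2 ^ k) • Q i ∈ (⊥ : AddSubgroup (localPoints W (v'.adicCompletion ℚ)))) ∧
        ∀ (τ : ↥(localSubgroupOfEmb κ.kerSubgroup (closureEmb (K := ℚ) (v'.adicCompletion ℚ)))) (i : Fin n),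
          pointsMapOfEmb W (closureEmb (K := ℚ) (v'.adicCompletion ℚ))
            ((Θ v' hv' (φ.1 (resGalSubgroupOfEmb κ.kerSubgroup (closureEmb (K := ℚ) (v'.adicCompletion ℚ)) τ)) i :
              ↥(W.geomPrimaryTorsion 2)) : W.geomPoints) = (τ : absoluteGaloisGroup (v'.adicCompletion ℚ)) • Q i - Q i) ∧
    (∀ w ∈ S₀, ∀ σ : absoluteGaloisGroup ℚ,
      conjH1 κ.kerSubgroup (Cofree ρ ↥(padicCoeffField S)) σ (s : subgroupH1 κ.kerSubgroup (Cofree ρ ↥(padicCoeffField S))) ∈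
        unramifiedKer κ.kerSubgroup (Cofree ρ ↥(padicCoeffField S)) w)

variable {S κ γ ρ}

/-- `𝐇¹ ⧸ Λ_𝒪 z` — the zeta quotient of Kato's module `I` by the `Λ_𝒪`-span of a class `z` (reducible type abbreviation; it does not depend on
the pins, only on `I`). [cite: Kato2004Asterisque, Thm. 12.5 (2) (p. 222)] -/
abbrev zetaQuot (z : I.H) : Type :=
  I.H ⧸ Submodule.span (IwasawaAlgebraO S) ({z} : Set I.H)

namespace OnePairPins

variable {W S₀ n Θ hΘ I Sg}
variable (π : OnePairPins S W κ γ S₀ n ρ Θ hΘ I Sg)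

/-- `𝒸 x := (col (locd₂ x ∘ single i))_i ∈ ℤ₂⟦X⟧ⁿ` — the coordinates of a class of `𝐇¹` under the plus Coleman map through the glue.
[cite: Kobayashi2003, Thm. 6.2 (p. 18)] -/
def cvec (x : I.H) : Fin n → PowerSeries ℤ_[2] :=
  fun i => π.col ((π.locd₂ x).comp (AddMonoidHom.single
    (fun _ : Fin n => ↥(Sprung2012.localTowerPointsOfEmb κ (closureEmb (K := ℚ) (π.v.adicCompletion ℚ)) W)) i))

/-- Unfolding `cvec` (definitional). [cite: Kobayashi2003, Thm. 6.2 (p. 18)] -/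
theorem cvec_apply (x : I.H) (i : Fin n) :
    π.cvec x i = π.col ((π.locd₂ x).comp (AddMonoidHom.single
      (fun _ : Fin n => ↥(Sprung2012.localTowerPointsOfEmb κ (closureEmb (K := ℚ) (π.v.adicCompletion ℚ)) W)) i)) :=
  rfl

/-- `ℤ₂⟦X⟧ⁿ ⧸ span_{ℤ₂⟦X⟧} 𝒸(Λ_𝒪 z)` — the plus-Coleman quotient attached to a class `z ∈ 𝐇¹` (reducible type abbreviation; its `λ_{ℤ₂}` is the
left side of Kato's explicit reciprocity count (i_D)). [cite: Kato2004Asterisque, Thm. 12.5 (1) (p. 222)] -/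
abbrev colocdQuot (z : I.H) : Type :=
  (Fin n → PowerSeries ℤ_[2]) ⧸ Submodule.span (PowerSeries ℤ_[2])
    (π.cvec '' (↑(Submodule.span (IwasawaAlgebraO S) ({z} : Set I.H)) : Set I.H))

/-- The residue pin as a theorem about `π`: `pair m x Q mod 2^k = rhoLayerPairingPk … m k x Q`. [cite: Kobayashi2003, (8.23) (p. 18)] -/
theorem toZModPow_pair (m k : ℕ) (x : H1 (FramedGaloisRep.toGaloisRep ρ) (κ.layerSubgroup m))
    (Q : Fin n → ↥(localLayerPointsOfEmb κ (closureEmb (K := ℚ) (π.v.adicCompletion ℚ)) W m)) :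
    PadicInt.toZModPow k (π.pair m x Q) =
      CyclotomicLayer.rhoLayerPairingPk S ρ W π.ePk π.hμPk π.hadd₁Pk π.hadd₂Pk π.hgalPk (Θ π.v π.hv) κ π.v (hΘ π.v π.hv) m k x Q :=
  π.hpair m k x Q

/-- The layer pin of the glue as a theorem about `π`: `locd₂ x (Q at layer m) = pair m (proj_m x) Q`. [cite: PerrinRiou1994Invent, §3.6.1] -/
theorem locd₂_layer (m : ℕ) (x : I.H) (Q : Fin n → localPoints W (π.v.adicCompletion ℚ))
    (hQ : ∀ i, Q i ∈ localLayerPointsOfEmb κ (closureEmb (K := ℚ) (π.v.adicCompletion ℚ)) W m) :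
    π.locd₂ x (fun i => ⟨Q i, Sprung2012.localLayerPointsOfEmb_le_localTowerPointsOfEmb κ (closureEmb (K := ℚ) (π.v.adicCompletion ℚ)) W m (hQ i)⟩) =
      π.pair m (I.proj m x) (fun i => ⟨Q i, hQ i⟩) :=
  π.hlocd₂ m x Q hQ

/-- The kernel pin of the plus Coleman map as a theorem about `π`. [cite: Kobayashi2003, Thm. 6.2 (p. 18)] -/
theorem col_eq_zero_iff (z : ↥(Sprung2012.localTowerPointsOfEmb κ (closureEmb (K := ℚ) (π.v.adicCompletion ℚ)) W) →+ ℤ_[2]) :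
    π.col z = 0 ↔ ∀ (m : ℕ) (x : localPoints W (π.v.adicCompletion ℚ)) (hx : x ∈ signedLocalPoints κ (π.v.adicCompletion ℚ) W 1 m),
      z ⟨x, Sprung2012.localLayerPointsOfEmb_le_localTowerPointsOfEmb κ (closureEmb (K := ℚ) (π.v.adicCompletion ℚ)) W m
        (signedLocalPointsOfEmb_le κ (closureEmb (K := ℚ) (π.v.adicCompletion ℚ)) W 1 m hx)⟩ = 0 :=
  π.hcol_ker z

/-- `B` is `ℤ₂`-linear, as a theorem about `π`. [cite: Kato2004Asterisque, §13.8 (p. 228)] -/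
theorem B_smul (c : ℤ_[2]) (y : Fin π.f → ℤ_[2]) : π.B (c • y) = padicIntToCoeffIntegers S c * π.B y :=
  π.hB c y

/-- Membership in `Sel₀` as a theorem about `π`: strict at the places above `2`, unramified (primitive) at `S₀`.
[cite: Kato2004Asterisque, Thm. 12.5 (2) (p. 222)] -/
theorem mem_Sel₀_iff (s : ↥Sg) : s ∈ π.Sel₀ ↔
    (∀ (v' : HeightOneSpectrum (𝓞 ℚ)) (hv' : ((2 : ℕ) : 𝓞 ℚ) ∈ v'.asIdeal) (σ : absoluteGaloisGroup ℚ),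
      ∃ (φ : contOneCocycles (discreteTopRep ↥κ.kerSubgroup (Cofree ρ ↥(padicCoeffField S))))
        (Q : Fin n → localPoints W (v'.adicCompletion ℚ)) (k : ℕ),
        oneCocycleClass (discreteTopRep ↥κ.kerSubgroup (Cofree ρ ↥(padicCoeffField S))) φ =
          conjH1 κ.kerSubgroup (Cofree ρ ↥(padicCoeffField S)) σ (s : subgroupH1 κ.kerSubgroup (Cofree ρ ↥(padicCoeffField S))) ∧
        (∀ i, (2 ^ k) • Q i ∈ (⊥ : AddSubgroup (localPoints W (v'.adicCompletion ℚ)))) ∧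
        ∀ (τ : ↥(localSubgroupOfEmb κ.kerSubgroup (closureEmb (K := ℚ) (v'.adicCompletion ℚ)))) (i : Fin n),
          pointsMapOfEmb W (closureEmb (K := ℚ) (v'.adicCompletion ℚ))
            ((Θ v' hv' (φ.1 (resGalSubgroupOfEmb κ.kerSubgroup (closureEmb (K := ℚ) (v'.adicCompletion ℚ)) τ)) i :
              ↥(W.geomPrimaryTorsion 2)) : W.geomPoints) = (τ : absoluteGaloisGroup (v'.adicCompletion ℚ)) • Q i - Q i) ∧
    (∀ w ∈ S₀, ∀ σ : absoluteGaloisGroup ℚ,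
      conjH1 κ.kerSubgroup (Cofree ρ ↥(padicCoeffField S)) σ (s : subgroupH1 κ.kerSubgroup (Cofree ρ ↥(padicCoeffField S))) ∈
        unramifiedKer κ.kerSubgroup (Cofree ρ ↥(padicCoeffField S)) w) :=
  π.hSel₀ s

end OnePairPins

end Pins

/-! ## Type/Set-valued abbreviations of the crux habitat (for the re-typed S3″ and the S57 split texts under the ledger's 3 900-character
stub-record bound; appended 2026-08-29 by the LEAD g18 — DATA-valued only, every body VERBATIM a sub-term of the registered texts with
`Set.range ι ↦ S`, so that the adapters stay definitional) -/

section Habitat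

/-- `𝒪 := padicCoeffIntegers S` as a TYPE (the coefficient ring `O_λ` of the newform; reducible abbreviation of the coercion `↥(padicCoeffIntegers S)`).
[cite: Kato2004Asterisque, §14.9 (p. 239)] -/
abbrev coeffO {p : ℕ} [Fact p.Prime] (S : Set (PadicAlgCl p)) : Type :=
  ↥(padicCoeffIntegers S)

/-- `A_ρ := Cofree ρ F = F^d ⧸ 𝒪^d`, the cofree (discrete, divisible) module of the framed representation `ρ`, as a TYPE (reducible abbreviation).
[cite: Kato2004Asterisque, §14.9 (p. 239)] -/
abbrev CofreeF {p : ℕ} [Fact p.Prime] (S : Set (PadicAlgCl p)) {d : ℕ} (ρ : FramedGaloisRep ℚ ↥(padicCoeffIntegers S) d) : Type :=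
  Cofree ρ ↥(padicCoeffField S)

/-- `H¹(Γ_∞, A_ρ) := subgroupH1 κ.kerSubgroup (Cofree ρ F)` — the home of the Selmer-type sets of the crux — as a TYPE (reducible abbreviation).
[cite: Kato2004Asterisque, §12.2 (p. 220)] -/
abbrev H1Γ {p : ℕ} [Fact p.Prime] (S : Set (PadicAlgCl p)) (κ : ZpExtension ℚ p) {d : ℕ}
    (ρ : FramedGaloisRep ℚ ↥(padicCoeffIntegers S) d) : Type :=
  subgroupH1 κ.kerSubgroup (Cofree ρ ↥(padicCoeffField S))

variable (S : Set (PadicAlgCl 2)) (W : WeierstrassCurve ℚ) [W.IsElliptic] (κ : ZpExtension ℚ 2)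
  (S₀ : Finset (HeightOneSpectrum (𝓞 ℚ))) (n : ℕ) (ρ : FramedGaloisRep ℚ ↥(padicCoeffIntegers S) 2)
  (Θ : ∀ v : HeightOneSpectrum (𝓞 ℚ), ((2 : ℕ) : 𝓞 ℚ) ∈ v.asIdeal → (Cofree ρ ↥(padicCoeffField S) ≃+ (Fin n → ↥(W.geomPrimaryTorsion 2))))

/-- **The signed (plus) Selmer SET `𝒮 ⊆ H¹(Γ_∞, A_ρ)` of the crux RSL_g**, VERBATIM the set-builder of its `hmem`/`hSg` binder (`Set.range ι ↦ S`):
classes unramified outside `2·S₀`, trivial at the real place (all conjugates), and at every place `v ∋ 2` and every conjugate represented by a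
cocycle whose restriction to `U_{∞,v}` is, through `Θ`, the Kummer cocycle of a tuple `Q` of `2`-power-divided PLUS points of the tower
(`⨆_m E⁺(ℚ_{m,v})`). A `Set` (data), not a `Prop`; membership `y ∈ plusSelmerSet …` unfolds to the registered comprehension definitionally.
[cite: Kobayashi2003, Def. 1.1 and Thm. 6.2] [cite: Greenberg1989, §1 p. 98 (3)] -/
abbrev plusSelmerSet : Set (subgroupH1 κ.kerSubgroup (Cofree ρ ↥(padicCoeffField S))) :=
  {y : subgroupH1 κ.kerSubgroup (Cofree ρ ↥(padicCoeffField S)) | y ∈ unramifiedOutside κ.kerSubgroup (Cofree ρ ↥(padicCoeffField S)) 2 ↑S₀ ∧ (∀ w σ, conjH1 κ.kerSubgroup (Cofree ρ ↥(padicCoeffField S)) σ y ∈ infKer κ.kerSubgroup (Cofree ρ ↥(padicCoeffField S)) w) ∧ (∀ v hv σ, ∃ (φ : _) (Q : Fin n → localPoints W (v.adicCompletion ℚ)) (k : ℕ), oneCocycleClass (discreteTopRep ↥κ.kerSubgroup (Cofree ρ ↥(padicCoeffField S))) φ = conjH1 κ.kerSubgroup (Cofree ρ ↥(padicCoeffField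 S)) σ y ∧ (∀ i, (2 ^ k) • Q i ∈ ⨆ m : ℕ, signedLocalPoints κ (v.adicCompletion ℚ) W 1 m) ∧ ∀ τ i, pointsMapOfEmb W (closureEmb (K := ℚ) (v.adicCompletion ℚ)) (((Θ v hv (φ.1 (resGalSubgroupOfEmb κ.kerSubgroup (closureEmb (K := ℚ) (v.adicCompletion ℚ)) τ))) i : ↥(W.geomPrimaryTorsion 2)) : W.geomPoints) = (τ : absoluteGaloisGroup (v.adicCompletion ℚ)) • Q i - Q i)}

/-- **The `ϖ`-torsion slice `𝒮[ϖ]` of the signed Selmer set** (the set whose finiteness is the crux's `hfin` binder), VERBATIM that binder's set-builder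
(`Set.range ι ↦ S`; the conjunction is kept right-nested exactly as registered, so it is NOT literally `plusSelmerSet ∩ …`).
[cite: Kobayashi2003, Def. 1.1 and Thm. 6.2] [cite: Greenberg1989, §1 p. 98 (3)] -/
abbrev plusSelmerTorsionSet (ϖ : ↥(padicCoeffIntegers S)) : Set (subgroupH1 κ.kerSubgroup (Cofree ρ ↥(padicCoeffField S))) :=
  {y : subgroupH1 κ.kerSubgroup (Cofree ρ ↥(padicCoeffField S)) | y ∈ unramifiedOutside κ.kerSubgroup (Cofree ρ ↥(padicCoeffField S)) 2 ↑S₀ ∧ (∀ w σ, conjH1 κ.kerSubgroup (Cofree ρ ↥(padicCoeffField S)) σ y ∈ infKer κ.kerSubgroup (Cofree ρ ↥(padicCoeffField S)) w) ∧ (∀ v hv σ, ∃ (φ : _) (Q : Fin n → localPoints W (v.adicCompletion ℚ)) (k : ℕ), oneCocycleClass (discreteTopRep ↥κ.kerSubgroup (Cofree ρ ↥(padicCoeffField S))) φ = conjH1 κ.kerSubgroup (Cofree ρ ↥(padicCoeffField S)) σ y ∧ (∀ i, (2 ^ k) • Q i ∈ ⨆ m : ℕ, signedLocalPoints κ (v.adicCompletion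 ℚ) W 1 m) ∧ ∀ τ i, pointsMapOfEmb W (closureEmb (K := ℚ) (v.adicCompletion ℚ)) (((Θ v hv (φ.1 (resGalSubgroupOfEmb κ.kerSubgroup (closureEmb (K := ℚ) (v.adicCompletion ℚ)) τ))) i : ↥(W.geomPrimaryTorsion 2)) : W.geomPoints) = (τ : absoluteGaloisGroup (v.adicCompletion ℚ)) • Q i - Q i) ∧ scalarH1 κ.kerSubgroup (Cofree ρ ↥(padicCoeffField S)) ϖ y = 0}

omit [W.IsElliptic] in
/-- Membership in `plusSelmerTorsionSet` is membership in `plusSelmerSet` plus `ϖ • y = 0` (re-association of the registered conjunction).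
[cite: Kobayashi2003, Def. 1.1] -/
theorem mem_plusSelmerTorsionSet_iff (ϖ : ↥(padicCoeffIntegers S)) (y : subgroupH1 κ.kerSubgroup (Cofree ρ ↥(padicCoeffField S))) :
    y ∈ plusSelmerTorsionSet S W κ S₀ n ρ Θ ϖ ↔
      y ∈ plusSelmerSet S W κ S₀ n ρ Θ ∧ scalarH1 κ.kerSubgroup (Cofree ρ ↥(padicCoeffField S)) ϖ y = 0 := by
  simp only [plusSelmerTorsionSet, plusSelmerSet, Set.mem_setOf_eq, and_assoc]

end Habitat

end Summit.BirchSwinnertonDyer.BirchSwinnertonDyer.Theorems.OnePair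

end
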